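import Literature.AnabelianGeometry.EtaleTheta.Discharge.Sec5CyclotomicRigidityOfBiKummerDataLaws
import Literature.AnabelianGeometry.SemiGraphs.TemperoidsGaloisHomTorsor
import HarnessLib

/-!
# [EtTh] Prop. 5.5 at the assembled §5 data over the GENUINE connected base `D := B^temp(Π^tp_X)⁰` — leaf (G) `hgal` DISCHARGED

Mochizuki, *The étale theta function …*, Publ. RIMS **45** (2009), Prop. 5.5, proof p.328 (PDF p.102) ("transport … by means of
linear morphisms `S″ → S` … independent of the choice"); Def. 3.6 (ii) p.302 (PDF p.76) ("`D` … a connected, totally epimorphic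
category" — print's superscript-`0` connected part) [cite: MochizukiEtTh2009, Prop 5.5 p.328 (PDF p.102)]; Mochizuki, *Semi-graphs of
anabelioids*, Publ. RIMS **42** (2006), Def. 3.1 (iv) p.33, Rmk. 3.1.3 p.34 [cite: MochizukiSemiAnbd2006, Rmk 3.1.3 p.34].

PROOF-ONLY (no definitions; seat abc-iut-w4-d099, cell abc-iut layer L2, row #5-R43 «P55/T56 FIXED-SOURCE LEAVES (G) hgal + hproj
at `ofBiKummerData`»).  Companion of `Discharge/Sec5Prop55GaloisLeafOfBiKummerData.lean` (same seat): there leaf (G) — the binder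
`hgal` of abc-iut-w5-d020's `ThetaFrobenioid.cyclotomicRigidity_ofBiKummerData_of_laws` (p420788) — was REDUCED, over the abstract
base `D` of the §4 setting, to the base-category law

  (L1)  `∀ A Galois, ∀ T, ∀ b b′ : A ⟶ T, ∃ g ∈ Aut_D(A), b′ = g ≫ b`   (plan/GAP-LEDGER.md G-w4d099-1).

Here the base IS the genuine one of [EtTh] §3–§5, `D := ConnectedPart (BTemp Π^tp_X) = B^temp(Π^tp_X)⁰` (abc-iut-L3's `BTemp`,
[FrdI] §0 connected part; NOT the full temperoid `BTemp Π^tp_X`, over which no tempered Frobenioid exists —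
`Discharge/Sec3TemperedFrobenioidBTempVacuity.lean`), and (L1) is a THEOREM
(`SemiGraphs/TemperoidsGaloisHomTorsor.lean`, `GaloisObjects.exists_aut_comp_eq_of_isGaloisObj_connectedPart`, p424508):
* `BiKummerSetting.galoisHomTorsor_of_connectedPart` — (L1) holds for EVERY §4 setting `S` over `B^temp(Π^tp_X)⁰` whose Galois
  predicate implies the [SemiAnbd] Def. 3.1 (iv) one on the underlying `Π^tp_X`-set (`hIG`; the identity for the canonical choice
  `IsGaloisObj := fun A => SemiGraphs.IsGaloisObj A.obj`) — independently of the chosen surjections `galoisSurj`;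
* `ThetaFrobenioid.linearBaseTorsor_ofBiKummerData_connectedPart` — hence leaf (G) for the §5 data `ofBiKummerData` assembled over
  such a setting, OUTRIGHT (binder shape of p420788: theta-saturated `T`, linear `φ, φ′ : B_N → T` — both idle);
* `ThetaFrobenioid.cyclotomicRigidity_ofBiKummerData_connectedPart` — [EtTh] Prop. 5.5 for these data = p420788 BY NAME with
  `hgal` DISCHARGED (binder list `… hσ hgeom hconst hreach hLc hLi hproj hcup` + `hIG`).
Leaf `hproj` stays named (law on the free subquotient data `(Q, P)`, GAP-LEDGER G-w4d099-2); `hcup` is abc-iut-L6-t23's row.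
Nothing of [EtTh] is asserted; typed ≠ proved for the named binders; no side taken on [IUTchIII] Cor. 3.12.
-/

noncomputable section

namespace Literature.AnabelianGeometry.EtaleTheta

open CategoryTheory Opposite FrobenioidCyclotomicRigidity Literature.AlgebraicGeometry.Frobenioids
  Literature.AnabelianGeometry.SemiGraphs

universe u₀ v₀ w

/-! ### (L1) for every §4 setting over the connected base `B^temp(Π^tp_X)⁰` -/

namespace BiKummerSetting

variable {K : Type u₀} [Field K] {X : SemiGraphs.TemperedArithmeticGroup.{u₀} K} {D₀ : Type u₀} [Category.{v₀} D₀]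
  {V : FrdIMonoidStub.{w}} {T₀ : RealifiedDivisorMonoids (D₀ := D₀) V}
  {VD : FrdICatStub.{u₀ + 1, u₀, w} (ConnectedPart (BTemp X.Pi))}

/-- **The law (L1) holds over the genuine connected base**: for a §4 setting `S` over `D := B^temp(Π^tp_X)⁰` whose Galois objects
are Galois `Π^tp_X`-sets ([SemiAnbd] Def. 3.1 (iv)), every Galois object of `D` is an `Aut`-torsor over every target — by
`GaloisObjects.exists_aut_comp_eq_of_isGaloisObj_connectedPart`.  [cite: MochizukiSemiAnbd2006, Rmk 3.1.3 p.34] -/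
theorem galoisHomTorsor_of_connectedPart (S : BiKummerSetting X T₀ (ConnectedPart (BTemp X.Pi)) VD)
    (hIG : ∀ A : ConnectedPart (BTemp X.Pi), S.IsGaloisObj A → SemiGraphs.IsGaloisObj A.obj) :
    ∀ ⦃A : ConnectedPart (BTemp X.Pi)⦄, S.IsGaloisObj A →
      ∀ ⦃T : ConnectedPart (BTemp X.Pi)⦄ (b b' : A ⟶ T), ∃ g : Aut A, b' = g.hom ≫ b :=
  fun A hA T b b' => GaloisObjects.exists_aut_comp_eq_of_isGaloisObj_connectedPart A T (hIG A hA) b b'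

end BiKummerSetting

/-! ### Leaf (G) and Prop. 5.5 for the §5 data assembled over such a setting -/

namespace ThetaFrobenioid

variable {K : Type u₀} [Field K] {X : SemiGraphs.TemperedArithmeticGroup.{u₀} K} {D₀ : Type u₀} [Category.{v₀} D₀]
  {V : FrdIMonoidStub.{w}} {T₀ : RealifiedDivisorMonoids (D₀ := D₀) V}
  {VD : FrdICatStub.{u₀ + 1, u₀, w} (ConnectedPart (BTemp X.Pi))} {S : BiKummerSetting X T₀ (ConnectedPart (BTemp X.Pi)) VD}
  {pullFrac : ∀ {A A' : S.C} (_ : A' ⟶ A), S.biratUnits A → S.biratUnits A'}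
  {lv N : ℕ+} {l' : ℕ} {RD : RigidData.{max u₀ w} N l'} {θ : S.biratUnits S.Aodot} {Bl : S.C}
  {Pl : S.FractionPair θ Bl} {Rl : S.NthRoot θ Pl lv pullFrac}
  (h : ModelFrobenioid.Hypotheses S.tf.divisorMonoid S.tf.ratFnFunctor)
  (toB : ∀ A : S.C, S.biratUnits A →* S.tf.biratUnitsModel A)
  (Q : FrobenioidTheta.ThetaSubquotientStub.{w} (ConnectedPart (BTemp X.Pi)))
  (odd_l : Odd (lv : ℕ)) (R : S.NthRoot Rl.root Rl.pair N pullFrac) (ιX : RD.PiX ≃ₜ* X.Pi)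
  (hopen : IsOpen ((S.galoisSurj R.AN.base R.αData.isGalois).ker : Set X.Pi)) (σ : Aut R.AN.base →* Aut R.AN)
  (K' : Type w) [Field K'] (constEmb : K'ˣ →* S.tf.biratUnitsModel R.BN)
  (constEmb_injective : Function.Injective constEmb)
  (hdivc : ∀ g : Aut R.BN.base,
    ModelFrobenioid.div ((σ ((BiKummerSetting.NthRoot.baseIso S R).conjAut.symm g)).hom ≫ R.pair.num) =
      ModelFrobenioid.div R.pair.num)
  (hdivp : ∀ y : RD.PiYdd,
    ModelFrobenioid.div ((σ (S.galoisSurj R.AN.base R.αData.isGalois (ιX y.1))).hom ≫ R.pair.den) =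
      ModelFrobenioid.div R.pair.den)

/-- **Leaf (G) `hgal` DISCHARGED over the connected base**: for the §5 data assembled over a §4 setting on `B^temp(Π^tp_X)⁰` (Galois
predicate = [SemiAnbd] Def. 3.1 (iv), `hIG`), the base arrows of any two morphisms `φ, φ′ : B_N → T` differ by an automorphism of
`B_N^bs` — in the binder shape of p420788 (theta-saturated `T`, linear `φ, φ′`; idle).  Proof: (L1) at the Galois `N`-domain
`A_N^bs` (Def. 4.1 (iv)(a)) transported along `(s^⊓_N)^bs : A_N^bs ⥲ B_N^bs`.  [cite: MochizukiEtTh2009, Prop 5.5 p.328 (PDF p.102)] -/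
theorem linearBaseTorsor_ofBiKummerData_connectedPart
    (hIG : ∀ A : ConnectedPart (BTemp X.Pi), S.IsGaloisObj A → SemiGraphs.IsGaloisObj A.obj) :
    ∀ (T : S.C),
      (ofBiKummerData h toB Q odd_l R ιX hopen σ K' constEmb constEmb_injective hdivc hdivp).IsThetaSaturated T →
      ∀ (φ φ' : (ofBiKummerData h toB Q odd_l R ιX hopen σ K' constEmb constEmb_injective hdivc hdivp).BN ⟶ T),
        (ofBiKummerData h toB Q odd_l R ιX hopen σ K' constEmb constEmb_injective hdivc hdivp).IsLinear φ →
        (ofBiKummerData h toB Q odd_l R ιX hopen σ K' constEmb constEmb_injective hdivc hdivp).IsLinear φ' →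
          ∃ g : Aut ((ofBiKummerData h toB Q odd_l R ιX hopen σ K' constEmb constEmb_injective hdivc hdivp).base.obj
              (ofBiKummerData h toB Q odd_l R ιX hopen σ K' constEmb constEmb_injective hdivc hdivp).BN),
            (ofBiKummerData h toB Q odd_l R ιX hopen σ K' constEmb constEmb_injective hdivc hdivp).base.map φ' =
              g.hom ≫ (ofBiKummerData h toB Q odd_l R ιX hopen σ K' constEmb constEmb_injective hdivc hdivp).base.map φ := by
  intro T _ φ φ' _ _
  change ∃ g : Aut R.BN.base, ModelFrobenioid.baseMap φ' = g.hom ≫ ModelFrobenioid.baseMap φ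
  obtain ⟨g, hg⟩ := BiKummerSetting.galoisHomTorsor_of_connectedPart S hIG R.αData.isGalois
    ((BiKummerSetting.NthRoot.baseIso S R).hom ≫ ModelFrobenioid.baseMap φ)
    ((BiKummerSetting.NthRoot.baseIso S R).hom ≫ ModelFrobenioid.baseMap φ')
  refine ⟨(BiKummerSetting.NthRoot.baseIso S R).conjAut g, ?_⟩
  rw [Iso.conjAut_hom, Iso.conj_apply, Category.assoc, Category.assoc]
  exact ((BiKummerSetting.NthRoot.baseIso S R).eq_inv_comp).mpr hg

/-- **[EtTh] Proposition 5.5 for the §5 data assembled over the genuine connected base, leaf (G) DISCHARGED**: abc-iut-w5-d020's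
`cyclotomicRigidity_ofBiKummerData_of_laws` BY NAME with `hgal := linearBaseTorsor_ofBiKummerData_connectedPart`; the other binders
verbatim (`hproj`, `hcup` stay named).  [cite: MochizukiEtTh2009, Prop 5.5 p.327–328 (PDF pp.101–102)] -/
theorem cyclotomicRigidity_ofBiKummerData_connectedPart
    (hIG : ∀ A : ConnectedPart (BTemp X.Pi), S.IsGaloisObj A → SemiGraphs.IsGaloisObj A.obj)
    (hB : (ofBiKummerData h toB Q odd_l R ιX hopen σ K' constEmb constEmb_injective hdivc hdivp).IsThetaSaturated
      (ofBiKummerData h toB Q odd_l R ιX hopen σ K' constEmb constEmb_injective hdivc hdivp).BN)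
    (P : ThetaSubquotientProj (ofBiKummerData h toB Q odd_l R ιX hopen σ K' constEmb constEmb_injective hdivc hdivp))
    {η₀ : RD.PiYdd → RD.mu} (hη₀ : η₀ ∈ RD.thetaCocycles)
    (hdies : ∀ k : RD.PiYdd, rhoOfBiKummerData R ιX k = 1 → η₀ k = 1)
    (e : RD.mu → (ofBiKummerData h toB Q odd_l R ιX hopen σ K' constEmb constEmb_injective hdivc hdivp).lDeltaModN
      (ofBiKummerData h toB Q odd_l R ιX hopen σ K' constEmb constEmb_injective hdivc hdivp).BN)
    (he : Function.Surjective e)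
    (hlift : ∀ a ∈ (ofBiKummerData h toB Q odd_l R ιX hopen σ K' constEmb constEmb_injective hdivc hdivp).HB,
      a ∈ P.pre _ → ∃ k : RD.PiYdd, (k : RD.PiX) ∈ RD.lDeltaTheta ∧ rhoOfBiKummerData R ιX k = a)
    (hpre : ∀ k : RD.PiYdd, (k : RD.PiX) ∈ RD.lDeltaTheta → rhoOfBiKummerData R ιX k ∈ P.pre _)
    (hP : ∀ (k : RD.PiYdd) (hk : (k : RD.PiX) ∈ RD.lDeltaTheta) (hm : rhoOfBiKummerData R ιX k ∈ P.pre _),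
      (QuotientGroup.mk (P.proj _ ⟨rhoOfBiKummerData R ιX k, hm⟩) :
          (ofBiKummerData h toB Q odd_l R ιX hopen σ K' constEmb constEmb_injective hdivc hdivp).lDeltaModN
            (ofBiKummerData h toB Q odd_l R ιX hopen σ K' constEmb constEmb_injective hdivc hdivp).BN) =
        e (RD.thetaMod ⟨k, hk⟩))
    (ν : (ofBiKummerData h toB Q odd_l R ιX hopen σ K' constEmb constEmb_injective hdivc hdivp).lDeltaModN
        (ofBiKummerData h toB Q odd_l R ιX hopen σ K' constEmb constEmb_injective hdivc hdivp).BN ≃*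
      (ofBiKummerData h toB Q odd_l R ιX hopen σ K' constEmb constEmb_injective hdivc hdivp).muTorsion
        (ofBiKummerData h toB Q odd_l R ιX hopen σ K' constEmb constEmb_injective hdivc hdivp).BN
        (ofBiKummerData h toB Q odd_l R ιX hopen σ K' constEmb constEmb_injective hdivc hdivp).N)
    (hK : ∀ η : (ofBiKummerData h toB Q odd_l R ιX hopen σ K' constEmb constEmb_injective hdivc hdivp).HB →
        (ofBiKummerData h toB Q odd_l R ιX hopen σ K' constEmb constEmb_injective hdivc hdivp).lDeltaModN
          (ofBiKummerData h toB Q odd_l R ιX hopen σ K' constEmb constEmb_injective hdivc hdivp).BN,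
      (∀ k : RD.PiYdd, η ⟨rhoOfBiKummerData R ιX k, Subgroup.mem_map_of_mem _ k.2⟩ = e (η₀ k)) →
        FrobenioidThetaBiKummer.ThetaPairKummerClass
          (ofBiKummerData h toB Q odd_l R ιX hopen σ K' constEmb constEmb_injective hdivc hdivp) η ν)
    (hσ : ∀ g : Aut R.AN.base, ModelFrobenioid.baseMap (σ g).hom = g.hom)
    (hgeom : P.pre R.BN.base ≤ RD.aug.ker.map (rhoOfBiKummerData R ιX))
    (hconst : ∀ δ ∈ RD.aug.ker, ∀ τ : ModelFrobenioid.units R.BN,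
      (S.tf.ratFnFunctor.map (rhoOfBiKummerData R ιX δ).hom.op).hom (ModelFrobenioid.unit τ.1.hom) =
        ModelFrobenioid.unit τ.1.hom)
    (hreach : LinearlyReachableFromBN
      (ofBiKummerData h toB Q odd_l R ιX hopen σ K' constEmb constEmb_injective hdivc hdivp))
    (hLc : Thm56Sub.LDeltaMapComp
      (ofBiKummerData h toB Q odd_l R ιX hopen σ K' constEmb constEmb_injective hdivc hdivp))
    (hLi : Thm56Sub.LDeltaMapId
      (ofBiKummerData h toB Q odd_l R ιX hopen σ K' constEmb constEmb_injective hdivc hdivp))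
    -- the two structural leaves that stay NAMED at the data (laws on the free stub `Q` / `P`, and on `s^⊔-gp`)
    (hproj : ∀ (g g' : Aut ((ofBiKummerData h toB Q odd_l R ιX hopen σ K' constEmb constEmb_injective hdivc hdivp).base.obj
        (ofBiKummerData h toB Q odd_l R ιX hopen σ K' constEmb constEmb_injective hdivc hdivp).BN))
        (hh : g' ∈ P.pre _), ∃ hgh : g * g' * g⁻¹ ∈ P.pre _,
          (ofBiKummerData h toB Q odd_l R ιX hopen σ K' constEmb constEmb_injective hdivc hdivp).lDeltaMap g.hom
              (P.proj _ ⟨g', hh⟩) = P.proj _ ⟨g * g' * g⁻¹, hgh⟩)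
    (hcup : ∀ (g : Aut ((ofBiKummerData h toB Q odd_l R ιX hopen σ K' constEmb constEmb_injective hdivc hdivp).base.obj
        (ofBiKummerData h toB Q odd_l R ιX hopen σ K' constEmb constEmb_injective hdivc hdivp).BN))
        (k : (ofBiKummerData h toB Q odd_l R ιX hopen σ K' constEmb constEmb_injective hdivc hdivp).HB),
        (k : Aut ((ofBiKummerData h toB Q odd_l R ιX hopen σ K' constEmb constEmb_injective hdivc hdivp).base.obj
          (ofBiKummerData h toB Q odd_l R ιX hopen σ K' constEmb constEmb_injective hdivc hdivp).BN)) ∈ P.pre _ →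
        ∃ hmem : g * (k : Aut ((ofBiKummerData h toB Q odd_l R ιX hopen σ K' constEmb constEmb_injective hdivc hdivp).base.obj
            (ofBiKummerData h toB Q odd_l R ιX hopen σ K' constEmb constEmb_injective hdivc hdivp).BN)) * g⁻¹ ∈
            (ofBiKummerData h toB Q odd_l R ιX hopen σ K' constEmb constEmb_injective hdivc hdivp).HB,
          (ofBiKummerData h toB Q odd_l R ιX hopen σ K' constEmb constEmb_injective hdivc hdivp).sgpCup
              ⟨g * (k : Aut ((ofBiKummerData h toB Q odd_l R ιX hopen σ K' constEmb constEmb_injective hdivc hdivp).base.obj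
                (ofBiKummerData h toB Q odd_l R ιX hopen σ K' constEmb constEmb_injective hdivc hdivp).BN)) * g⁻¹, hmem⟩ =
            (ofBiKummerData h toB Q odd_l R ιX hopen σ K' constEmb constEmb_injective hdivc hdivp).sgpCap g *
              (ofBiKummerData h toB Q odd_l R ιX hopen σ K' constEmb constEmb_injective hdivc hdivp).sgpCup k *
              ((ofBiKummerData h toB Q odd_l R ιX hopen σ K' constEmb constEmb_injective hdivc hdivp).sgpCap g)⁻¹) :
    CyclotomicRigidity (ofBiKummerData h toB Q odd_l R ιX hopen σ K' constEmb constEmb_injective hdivc hdivp) P hB :=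
  cyclotomicRigidity_ofBiKummerData_of_laws h toB Q odd_l R ιX hopen σ K' constEmb constEmb_injective hdivc hdivp hB P hη₀
    hdies e he hlift hpre hP ν hK hσ hgeom hconst hreach hLc hLi
    (linearBaseTorsor_ofBiKummerData_connectedPart h toB Q odd_l R ιX hopen σ K' constEmb constEmb_injective hdivc hdivp hIG)
    hproj hcup

end ThetaFrobenioid

end Literature.AnabelianGeometry.EtaleTheta

end
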